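import Mathlib
import Summits.ResolutionOfSingularities.ResolutionOfSingularities.Theorems.HomologicalConductorPersistenceVeronesePieces
import HarnessLib

/-!
# The graded pieces of `k[a,b,u]` over the Veronese cylinder, II: `Ω M₂ = M₂ ⊕ M₂` and `Ω(a·)`, `Ω(b·)`

Crux `HomologicalConductor.Persistence` (stmt-ResolutionOfSingularities-16484), chain W4.4b, rung L1; helper for
T-HOLD = `PersistenceVeroneseDefs.CubicsLevelFive` (bricks B2/B3 of res-L1-w44b-stub-3's THOLD-MECHANISM memo,
evidence #55 on the crux item), continuing `…PersistenceVeronesePieces.lean` (part I: `piece`, `cover₁`, `syz₁`,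
`0 → P₂ → R² → P₁ → 0`). `[OURS · L1 w44b]` — elementary commutative algebra of ONE stage of the route's `ca`-tower;
NOT a statement of the manuscript under review, and no statement of that manuscript is used; AI-written (weaker than
expert review). `R = veroneseCylinder k = k[a³,a²b,ab²,b³,u]`, `P₂ = M₂[u] = Ra² + Rab + Rb²`. This file:

* `cover₂ : R³ → P₂`, `(r,s,w) ↦ ra² + sab + wb²`, onto (`cover₂_surjective`); `syz₂ : P₂ × P₂ → R³`,
  `(f,g) ↦ (fb, gb - fa, -ga)`, injective (`syz₂_injective`); `exact_syz₂_cover₂` : `0 → P₂² → R³ → P₂ → 0` is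
  exact — «`Ω M₂ = M₂ ⊕ M₂`» (every characteristic);
* `liftA`, `liftB : R² → R³` — the lifts of `a·`, `b· : P₁ → P₂` to the covers (`cover₂_comp_liftA/B`), and their
  restriction to the syzygies: `liftA_comp_syz₁ : liftA ∘ syz₁ = syz₂ ∘ inl`, `liftB_comp_syz₁ : liftB ∘ syz₁ = syz₂ ∘ inr`
  — «`Ω(a·) = (1,0)ᵀ`, `Ω(b·) = (0,1)ᵀ : M₂ → M₂ ⊕ M₂`», the computation behind the level-FIVE absorption of the
  memo (§4.3–4.4: after one `Ω` the linear forms `M₁ → M₂` become scalar columns).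
-/

-- single-problem summit: the doubled namespace component is forced
set_option linter.dupNamespace false
-- `Module ↥(veroneseCylinder k) ↥(piece k g)` (a submodule over a subalgebra used as base ring) is found by
-- instance search, but slowly (≈ 4× the default budget); nothing else is affected.
set_option synthInstance.maxHeartbeats 100000

noncomputable section

universe u

namespace Summit.ResolutionOfSingularities.ResolutionOfSingularities.Theorems.HomologicalConductor.PersistenceVeroneseSyzygyTwo

open MvPolynomial
open Summit.ResolutionOfSingularities.ResolutionOfSingularities.Theorems.HomologicalConductor.PersistenceVeroneseDefs
open Summit.ResolutionOfSingularities.ResolutionOfSingularities.Theorems.HomologicalConductor.PersistenceVeroneseExponentTwo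
  (isWeightedHomogeneous_of_eq)
open Summit.ResolutionOfSingularities.ResolutionOfSingularities.Theorems.HomologicalConductor.PersistenceVeronesePieces

variable (k : Type u) [Field k]

/-! ## The cover `R³ → P₂` and its kernel `P₂ × P₂` («`Ω M₂ = M₂ ⊕ M₂`») -/

/-- The generators `a², ab, b²` of `P₂`. [OURS · L1 w44b] -/
def gen₂ : Fin 3 → piece k 2 :=
  ![⟨X 0 ^ 2, isWeightedHomogeneous_of_eq k veroneseWeight ((isWeightedHomogeneous_a k).pow 2) (by decide)⟩,
    ⟨X 0 * X 1, isWeightedHomogeneous_of_eq k veroneseWeight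
      ((isWeightedHomogeneous_a k).mul (isWeightedHomogeneous_b k)) (by decide)⟩,
    ⟨X 1 ^ 2, isWeightedHomogeneous_of_eq k veroneseWeight ((isWeightedHomogeneous_b k).pow 2) (by decide)⟩]

/-- [OURS · L1 w44b] The standard cover `R³ → P₂`, `(r, s, w) ↦ r a² + s ab + w b²`. -/
def cover₂ : (Fin 3 → veroneseCylinder k) →ₗ[veroneseCylinder k] piece k 2 :=
  Fintype.linearCombination (veroneseCylinder k) (gen₂ k)

/-- Underlying polynomial of `cover₂ v`. [OURS · L1 w44b] -/
theorem coe_cover₂ (v : Fin 3 → veroneseCylinder k) :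
    ((cover₂ k v : piece k 2) : MvPolynomial (Fin 3) k) =
      (v 0 : MvPolynomial (Fin 3) k) * X 0 ^ 2 + (v 1 : MvPolynomial (Fin 3) k) * (X 0 * X 1)
        + (v 2 : MvPolynomial (Fin 3) k) * X 1 ^ 2 := by
  simp [cover₂, Fintype.linearCombination_apply, Fin.sum_univ_three, gen₂, Subalgebra.smul_def, smul_eq_mul]

/-- [OURS · L1 w44b] The syzygy map `P₂ × P₂ → R³`, `(f, g) ↦ (f b, g b - f a, -g a)`: the two Koszul relations
`b·(a²) = a·(ab)`, `b·(ab) = a·(b²)` with coefficients `f, g ∈ P₂`. -/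
def syz₂ : (piece k 2 × piece k 2) →ₗ[veroneseCylinder k] (Fin 3 → veroneseCylinder k) :=
  LinearMap.pi ![mulB k ∘ₗ LinearMap.fst _ _ _,
    mulB k ∘ₗ LinearMap.snd _ _ _ - mulA k ∘ₗ LinearMap.fst _ _ _,
    -(mulA k ∘ₗ LinearMap.snd _ _ _)]

/-- First component of `syz₂ (f, g)` is `f b`. [OURS · L1 w44b] -/
theorem coe_syz₂_zero (fg : piece k 2 × piece k 2) :
    ((syz₂ k fg 0 : veroneseCylinder k) : MvPolynomial (Fin 3) k) = (fg.1 : MvPolynomial (Fin 3) k) * X 1 := rfl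

/-- Second component of `syz₂ (f, g)` is `g b - f a`. [OURS · L1 w44b] -/
theorem coe_syz₂_one (fg : piece k 2 × piece k 2) :
    ((syz₂ k fg 1 : veroneseCylinder k) : MvPolynomial (Fin 3) k) =
      (fg.2 : MvPolynomial (Fin 3) k) * X 1 - (fg.1 : MvPolynomial (Fin 3) k) * X 0 := rfl

/-- Third component of `syz₂ (f, g)` is `-g a`. [OURS · L1 w44b] -/
theorem coe_syz₂_two (fg : piece k 2 × piece k 2) :
    ((syz₂ k fg 2 : veroneseCylinder k) : MvPolynomial (Fin 3) k) = -((fg.2 : MvPolynomial (Fin 3) k) * X 0) := rfl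

/-- `syz₂` is injective. [OURS · L1 w44b] -/
theorem syz₂_injective : Function.Injective (syz₂ k) := by
  rintro ⟨f, g⟩ ⟨f', g'⟩ h
  have h0 := congrArg (fun v => ((v 0 : veroneseCylinder k) : MvPolynomial (Fin 3) k)) h
  have h2 := congrArg (fun v => ((v 2 : veroneseCylinder k) : MvPolynomial (Fin 3) k)) h
  simp only [coe_syz₂_zero, coe_syz₂_two, neg_inj] at h0 h2
  exact Prod.ext (Subtype.ext (mul_right_cancel₀ (X_ne_zero 1) h0))
    (Subtype.ext (mul_right_cancel₀ (X_ne_zero 0) h2))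

/-- `cover₂ ∘ syz₂ = 0`. [OURS · L1 w44b] -/
theorem cover₂_syz₂ (fg : piece k 2 × piece k 2) : cover₂ k (syz₂ k fg) = 0 := by
  apply Subtype.ext
  rw [coe_cover₂, coe_syz₂_zero, coe_syz₂_one, coe_syz₂_two]
  change _ = (0 : MvPolynomial (Fin 3) k)
  ring

/-- **`0 → P₂ × P₂ → R³ → P₂` is exact**: the kernel of `(r,s,w) ↦ ra² + sab + wb²` is
`{(fb, gb - fa, -ga) : f, g ∈ P₂}` — the syzygy module of `M₂` is `M₂ ⊕ M₂` (every characteristic).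
[OURS · L1 w44b] -/
theorem exact_syz₂_cover₂ : Function.Exact (syz₂ k) (cover₂ k) := by
  intro v
  constructor
  · intro hv
    have h0 : (v 0 : MvPolynomial (Fin 3) k) * X 0 ^ 2 + (v 1 : MvPolynomial (Fin 3) k) * (X 0 * X 1)
        + (v 2 : MvPolynomial (Fin 3) k) * X 1 ^ 2 = 0 := by
      rw [← coe_cover₂, hv]
      rfl
    have h10 : ¬ ((X 1 : MvPolynomial (Fin 3) k) ∣ X 0) := fun h =>
      absurd (MvPolynomial.X_dvd_X.mp h) (by decide)
    have h01 : ¬ ((X 0 : MvPolynomial (Fin 3) k) ∣ X 1) := fun h =>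
      absurd (MvPolynomial.X_dvd_X.mp h) (by decide)
    -- `X 1 ∣ v 0` and `X 0 ∣ v 2`
    have hdvd0 : (X 1 : MvPolynomial (Fin 3) k) ∣ (v 0 : MvPolynomial (Fin 3) k) * (X 0 * X 0) :=
      ⟨-((v 1 : MvPolynomial (Fin 3) k) * X 0 + (v 2 : MvPolynomial (Fin 3) k) * X 1), by linear_combination h0⟩
    have hdvd2 : (X 0 : MvPolynomial (Fin 3) k) ∣ (v 2 : MvPolynomial (Fin 3) k) * (X 1 * X 1) :=
      ⟨-((v 0 : MvPolynomial (Fin 3) k) * X 0 + (v 1 : MvPolynomial (Fin 3) k) * X 1), by linear_combination h0⟩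
    obtain ⟨f, hf⟩ : (X 1 : MvPolynomial (Fin 3) k) ∣ (v 0 : MvPolynomial (Fin 3) k) := by
      rcases MvPolynomial.X_dvd_mul_iff.mp hdvd0 with h | h
      · exact h
      · rcases MvPolynomial.X_dvd_mul_iff.mp h with h' | h' <;> exact absurd h' h10
    obtain ⟨g, hg⟩ : (X 0 : MvPolynomial (Fin 3) k) ∣ (v 2 : MvPolynomial (Fin 3) k) := by
      rcases MvPolynomial.X_dvd_mul_iff.mp hdvd2 with h | h
      · exact h
      · rcases MvPolynomial.X_dvd_mul_iff.mp h with h' | h' <;> exact absurd h' h01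
    -- the middle coordinate
    have hv1 : (v 1 : MvPolynomial (Fin 3) k) = -(f * X 0) - g * X 1 := by
      have h1 : (X 0 * X 1 : MvPolynomial (Fin 3) k) * (f * X 0 + (v 1 : MvPolynomial (Fin 3) k) + g * X 1) = 0 := by
        linear_combination h0 - X 0 ^ 2 * hf - X 1 ^ 2 * hg
      rcases mul_eq_zero.mp h1 with h | h
      · exact absurd h (mul_ne_zero (X_ne_zero 0) (X_ne_zero 1))
      · linear_combination h
    have hf2 : IsWeightedHomogeneous veroneseWeight f 2 := by
      have h1 : IsWeightedHomogeneous veroneseWeight (v 0 : MvPolynomial (Fin 3) k) 0 :=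
        (mem_veroneseCylinder_iff k _).mp (v 0).2
      rw [hf] at h1
      exact isWeightedHomogeneous_of_eq k veroneseWeight (isWeightedHomogeneous_of_X_mul k veroneseWeight 1 h1)
        (by decide)
    have hg2 : IsWeightedHomogeneous veroneseWeight g 2 := by
      have h1 : IsWeightedHomogeneous veroneseWeight (v 2 : MvPolynomial (Fin 3) k) 0 :=
        (mem_veroneseCylinder_iff k _).mp (v 2).2
      rw [hg] at h1
      exact isWeightedHomogeneous_of_eq k veroneseWeight (isWeightedHomogeneous_of_X_mul k veroneseWeight 0 h1)
        (by decide)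
    refine ⟨(⟨f, hf2⟩, ⟨-g, (piece k 2).neg_mem hg2⟩), funext fun i => ?_⟩
    fin_cases i
    · apply Subtype.ext
      show ((syz₂ k (⟨f, hf2⟩, ⟨-g, (piece k 2).neg_mem hg2⟩) 0 : veroneseCylinder k) : MvPolynomial (Fin 3) k)
        = (v 0 : MvPolynomial (Fin 3) k)
      rw [coe_syz₂_zero, hf]
      change f * X 1 = _
      ring
    · apply Subtype.ext
      show ((syz₂ k (⟨f, hf2⟩, ⟨-g, (piece k 2).neg_mem hg2⟩) 1 : veroneseCylinder k) : MvPolynomial (Fin 3) k)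
        = (v 1 : MvPolynomial (Fin 3) k)
      rw [coe_syz₂_one, hv1]
      change (-g) * X 1 - f * X 0 = _
      ring
    · apply Subtype.ext
      show ((syz₂ k (⟨f, hf2⟩, ⟨-g, (piece k 2).neg_mem hg2⟩) 2 : veroneseCylinder k) : MvPolynomial (Fin 3) k)
        = (v 2 : MvPolynomial (Fin 3) k)
      rw [coe_syz₂_two, hg]
      change -((-g) * X 0) = _
      ring
  · rintro ⟨fg, rfl⟩
    exact cover₂_syz₂ k fg

/-- **`cover₂` is onto**: every weight-`2` polynomial is `r a² + s ab + w b²` with `r, s, w` of weight `0`.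
[OURS · L1 w44b] -/
theorem cover₂_surjective : Function.Surjective (cover₂ k) := by
  classical
  rintro ⟨p, hp⟩
  -- `p = X 0 * q + p₀`, `q` of weight `1`, `p₀` of weight `2` without `a`
  set q := p.divMonomial (Finsupp.single 0 1) with hq
  set p₀ := p.modMonomial (Finsupp.single 0 1) with hp₀
  have hsplit : X 0 * q + p₀ = p := divMonomial_add_modMonomial_single p 0
  have hqw : IsWeightedHomogeneous veroneseWeight q 1 :=
    isWeightedHomogeneous_of_eq k veroneseWeight (isWeightedHomogeneous_divMonomial k veroneseWeight 0 hp)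
      (by decide)
  -- `q = r a + s b` (part I)
  obtain ⟨rs, hrs⟩ := cover₁_surjective k ⟨q, hqw⟩
  have hq' : q = (rs 0 : MvPolynomial (Fin 3) k) * X 0 + (rs 1 : MvPolynomial (Fin 3) k) * X 1 := by
    rw [← coe_cover₁, hrs]
  -- `p₀ = X 1 * p₁`, `p₁ = X 1 * w`
  have hp₀w : IsWeightedHomogeneous veroneseWeight p₀ 2 := isWeightedHomogeneous_modMonomial k veroneseWeight 0 hp
  have hp₀0 : ∀ d ∈ p₀.support, d 0 = 0 := apply_eq_zero_of_mem_support_modMonomial k 0 p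
  have hp₀b : p₀ = X 1 * p₀.divMonomial (Finsupp.single 1 1) :=
    eq_X_mul_divMonomial k 1 p₀ (one_le_apply_one_of_weight k hp₀w (by decide) hp₀0)
  set p₁ := p₀.divMonomial (Finsupp.single 1 1) with hp₁
  have hp₁w : IsWeightedHomogeneous veroneseWeight p₁ 1 :=
    isWeightedHomogeneous_of_eq k veroneseWeight (isWeightedHomogeneous_divMonomial k veroneseWeight 1 hp₀w)
      (by decide)
  have hp₁0 : ∀ d ∈ p₁.support, d 0 = 0 := by
    intro d hd
    rw [mem_support_iff, hp₁, coeff_divMonomial] at hd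
    have := hp₀0 _ (mem_support_iff.mpr hd)
    simpa using this
  have hp₁b : p₁ = X 1 * p₁.divMonomial (Finsupp.single 1 1) :=
    eq_X_mul_divMonomial k 1 p₁ (one_le_apply_one_of_weight k hp₁w one_ne_zero hp₁0)
  set w := p₁.divMonomial (Finsupp.single 1 1) with hw
  have hww : IsWeightedHomogeneous veroneseWeight w 0 :=
    isWeightedHomogeneous_of_eq k veroneseWeight (isWeightedHomogeneous_divMonomial k veroneseWeight 1 hp₁w)
      (by decide)
  refine ⟨![rs 0, rs 1, ⟨w, (mem_veroneseCylinder_iff k w).mpr hww⟩], ?_⟩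
  apply Subtype.ext
  rw [coe_cover₂]
  change (rs 0 : MvPolynomial (Fin 3) k) * X 0 ^ 2 + (rs 1 : MvPolynomial (Fin 3) k) * (X 0 * X 1) + w * X 1 ^ 2 = p
  rw [← hsplit, hq', hp₀b, hp₁b]
  ring

/-! ## Lifting `a·` and `b·` to the covers: `Ω(a·) = (1,0)ᵀ`, `Ω(b·) = (0,1)ᵀ` -/

/-- `a` as a map `P₁ → P₂`: weight bookkeeping `1 = 2 - 1`. [OURS · L1 w44b] -/
theorem isWeightedHomogeneous_a'' :
    IsWeightedHomogeneous veroneseWeight (X 0 : MvPolynomial (Fin 3) k) ((2 : ZMod 3) - 1) :=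
  isWeightedHomogeneous_of_eq k veroneseWeight (isWeightedHomogeneous_a k) (by decide)

/-- `b` as a map `P₁ → P₂`: weight bookkeeping `1 = 2 - 1`. [OURS · L1 w44b] -/
theorem isWeightedHomogeneous_b'' :
    IsWeightedHomogeneous veroneseWeight (X 1 : MvPolynomial (Fin 3) k) ((2 : ZMod 3) - 1) :=
  isWeightedHomogeneous_of_eq k veroneseWeight (isWeightedHomogeneous_b k) (by decide)

/-- [OURS · L1 w44b] The lift of `a· : P₁ → P₂` to the covers: `(r, s) ↦ (r, s, 0)` (`a·a = a²`, `a·b = ab`). -/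
def liftA : (Fin 2 → veroneseCylinder k) →ₗ[veroneseCylinder k] (Fin 3 → veroneseCylinder k) :=
  LinearMap.pi ![LinearMap.proj 0, LinearMap.proj 1, 0]

/-- [OURS · L1 w44b] The lift of `b· : P₁ → P₂` to the covers: `(r, s) ↦ (0, r, s)` (`b·a = ab`, `b·b = b²`). -/
def liftB : (Fin 2 → veroneseCylinder k) →ₗ[veroneseCylinder k] (Fin 3 → veroneseCylinder k) :=
  LinearMap.pi ![0, LinearMap.proj 0, LinearMap.proj 1]

/-- Components of `liftA`. [OURS · L1 w44b] -/
theorem liftA_apply (v : Fin 2 → veroneseCylinder k) :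
    liftA k v 0 = v 0 ∧ liftA k v 1 = v 1 ∧ liftA k v 2 = 0 := ⟨rfl, rfl, rfl⟩

/-- Components of `liftB`. [OURS · L1 w44b] -/
theorem liftB_apply (v : Fin 2 → veroneseCylinder k) :
    liftB k v 0 = 0 ∧ liftB k v 1 = v 0 ∧ liftB k v 2 = v 1 := ⟨rfl, rfl, rfl⟩

/-- `liftA` covers multiplication by `a`: `cover₂ ∘ liftA = (a·) ∘ cover₁`. [OURS · L1 w44b] -/
theorem cover₂_comp_liftA :
    cover₂ k ∘ₗ liftA k = mulHom k 1 2 (X 0) (isWeightedHomogeneous_a'' k) ∘ₗ cover₁ k := by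
  refine LinearMap.ext fun v => Subtype.ext ?_
  show ((cover₂ k (liftA k v) : piece k 2) : MvPolynomial (Fin 3) k)
    = ((cover₁ k v : piece k 1) : MvPolynomial (Fin 3) k) * X 0
  rw [coe_cover₂, coe_cover₁, (liftA_apply k v).1, (liftA_apply k v).2.1, (liftA_apply k v).2.2]
  simp only [ZeroMemClass.coe_zero]
  ring

/-- `liftB` covers multiplication by `b`: `cover₂ ∘ liftB = (b·) ∘ cover₁`. [OURS · L1 w44b] -/
theorem cover₂_comp_liftB :
    cover₂ k ∘ₗ liftB k = mulHom k 1 2 (X 1) (isWeightedHomogeneous_b'' k) ∘ₗ cover₁ k := by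
  refine LinearMap.ext fun v => Subtype.ext ?_
  show ((cover₂ k (liftB k v) : piece k 2) : MvPolynomial (Fin 3) k)
    = ((cover₁ k v : piece k 1) : MvPolynomial (Fin 3) k) * X 1
  rw [coe_cover₂, coe_cover₁, (liftB_apply k v).1, (liftB_apply k v).2.1, (liftB_apply k v).2.2]
  simp only [ZeroMemClass.coe_zero]
  ring

/-- **`Ω(a·) = (1, 0)ᵀ`**: on syzygies the lift of `a·` is the first coordinate inclusion `P₂ → P₂ × P₂`:
`liftA ∘ syz₁ = syz₂ ∘ inl`. [OURS · L1 w44b] -/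
theorem liftA_comp_syz₁ : liftA k ∘ₗ syz₁ k = syz₂ k ∘ₗ LinearMap.inl _ _ _ := by
  refine LinearMap.ext fun t => funext fun i => Subtype.ext ?_
  fin_cases i
  · show ((liftA k (syz₁ k t) 0 : veroneseCylinder k) : MvPolynomial (Fin 3) k)
      = ((syz₂ k (t, 0) 0 : veroneseCylinder k) : MvPolynomial (Fin 3) k)
    rw [(liftA_apply k _).1, coe_syz₁_zero, coe_syz₂_zero]
  · show ((liftA k (syz₁ k t) 1 : veroneseCylinder k) : MvPolynomial (Fin 3) k)
      = ((syz₂ k (t, 0) 1 : veroneseCylinder k) : MvPolynomial (Fin 3) k)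
    rw [(liftA_apply k _).2.1, coe_syz₁_one, coe_syz₂_one]
    simp only [ZeroMemClass.coe_zero, zero_mul, zero_sub]
  · show ((liftA k (syz₁ k t) 2 : veroneseCylinder k) : MvPolynomial (Fin 3) k)
      = ((syz₂ k (t, 0) 2 : veroneseCylinder k) : MvPolynomial (Fin 3) k)
    rw [(liftA_apply k _).2.2, coe_syz₂_two]
    simp only [ZeroMemClass.coe_zero, zero_mul, neg_zero]

/-- **`Ω(b·) = (0, 1)ᵀ`**: on syzygies the lift of `b·` is the second coordinate inclusion:
`liftB ∘ syz₁ = syz₂ ∘ inr`. [OURS · L1 w44b] -/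
theorem liftB_comp_syz₁ : liftB k ∘ₗ syz₁ k = syz₂ k ∘ₗ LinearMap.inr _ _ _ := by
  refine LinearMap.ext fun t => funext fun i => Subtype.ext ?_
  fin_cases i
  · show ((liftB k (syz₁ k t) 0 : veroneseCylinder k) : MvPolynomial (Fin 3) k)
      = ((syz₂ k (0, t) 0 : veroneseCylinder k) : MvPolynomial (Fin 3) k)
    rw [(liftB_apply k _).1, coe_syz₂_zero]
    simp only [ZeroMemClass.coe_zero, zero_mul]
  · show ((liftB k (syz₁ k t) 1 : veroneseCylinder k) : MvPolynomial (Fin 3) k)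
      = ((syz₂ k (0, t) 1 : veroneseCylinder k) : MvPolynomial (Fin 3) k)
    rw [(liftB_apply k _).2.1, coe_syz₁_zero, coe_syz₂_one]
    simp only [ZeroMemClass.coe_zero, zero_mul, sub_zero]
  · show ((liftB k (syz₁ k t) 2 : veroneseCylinder k) : MvPolynomial (Fin 3) k)
      = ((syz₂ k (0, t) 2 : veroneseCylinder k) : MvPolynomial (Fin 3) k)
    rw [(liftB_apply k _).2.2, coe_syz₁_one, coe_syz₂_two]

end Summit.ResolutionOfSingularities.ResolutionOfSingularities.Theorems.HomologicalConductor.PersistenceVeroneseSyzygyTwo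

end
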